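import Literature.InformationTheory.QuantumCodes.LocalCodeDistanceBound
import HarnessLib

/-!
# Bravyi–Terhal 2009, Theorem 1 on the torus (`L ≥ 2(r−1)²`) — proof

[BravyiTerhal2009] §1.1 Thm 1 with §2 Prop. 1 («periodic boundary conditions … for any
`L ≥ 2(r−1)²`»): the tree's named fact `BravyiTerhal2009_thm1_periodic` (`LocalityBounds.lean`). This
file PROVES it (`BravyiTerhal2009_thm1_periodic_holds`), following the printed proof: partition the
circle of `L` columns into an EVEN number `K` of cyclically consecutive slabs of widths `r−1` and `r`
(possible as `L = a(r−1) + br` with `a + b` even when `L ≥ 2(r−1)²`), so that a generator — covered by a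
hypercube with `r^D` vertices taken modulo `L` — meets at most two cyclically adjacent slabs, which have
different parity; then the slab-parity core of `LocalCodeDistanceBound.lean` (here under the weaker
separation hypothesis «a generator meets at most one slab of each parity», which also covers the
wrap-around pair `(K−1, 0)`) gives `S̄⊥ ≤ S̄` unless some slab (≤ `r` columns, `≤ r·L^{D−1}` qubits)
supports a non-trivial logical operator.

## References

* [BravyiTerhal2009] §2 Lemma 1, Def. 1, Prop. 1 («Let `L = a(r−1) + br` … such that `a + b` is
  even»), proof of Thm 1 (arXiv:0810.1983 chunks p0009–p0010).
-/

namespace Literature.InformationTheory.QuantumCodes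

open Matrix Finset Module

variable {n : ℕ}

/-! ### Core under the separation hypothesis «at most one slab of each parity» -/

section Core

variable (β : Fin n → ℕ) {ι : Type*} (g : ι → SympVec n)

/-- Slab pieces of an element of `⟨g⟩⊥` supported on one parity class lie in `⟨g⟩⊥`, assuming every
generator meets at most one slab of each parity. [cite: BravyiTerhal2009, §2 proof of Prop. 1] -/
theorem proj_slab_mem_sympDual_of_parity
    (hsep : ∀ a, ∀ q ∈ sympSupport (g a), ∀ q' ∈ sympSupport (g a), β q % 2 = β q' % 2 → β q = β q')
    {p : ℕ} {P : SympVec n} (hPd : P ∈ sympDual (Submodule.span (ZMod 2) (Set.range g)))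
    (hPs : P ∈ supportedOn (parityClass β p)) {j : ℕ} (hj : j % 2 = p) :
    proj (slab β j) P ∈ sympDual (Submodule.span (ZMod 2) (Set.range g)) := by
  refine mem_sympDual_span_of_forall g fun a => ?_
  by_cases hmeet : ∃ q ∈ sympSupport (g a), β q = j
  · obtain ⟨q₀, hq₀, hq₀j⟩ := hmeet
    have hother : ∀ j' ∈ slabIndices β p, j' ≠ j → sympInner (g a) (proj (slab β j') P) = 0 := by
      intro j' hj' hne
      refine sympInner_proj_slab_eq_zero β g (fun q hq hqj' => ?_) P
      have hp' : j' % 2 = p := (mem_filter.1 hj').2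
      have := hsep a q₀ hq₀ q hq (by rw [hq₀j, hqj', hj, hp'])
      exact hne (by rw [← hqj', ← this, hq₀j])
    have htot : sympInner (g a) P = 0 :=
      (mem_sympDual_iff.1 hPd) (g a) (Submodule.subset_span ⟨a, rfl⟩)
    rw [eq_sum_proj_slab β hPs, sympInner_sum_right] at htot
    have hjmem : j ∈ slabIndices β p := by
      simp only [slabIndices, mem_filter, mem_image, mem_univ, true_and]
      exact ⟨⟨q₀, hq₀j⟩, hj⟩
    rw [← Finset.add_sum_erase _ _ hjmem,
      Finset.sum_eq_zero (fun j' hj' => hother j' (Finset.mem_of_mem_erase hj')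
        (Finset.ne_of_mem_erase hj')), add_zero] at htot
    exact htot
  · push Not at hmeet
    exact sympInner_proj_slab_eq_zero β g hmeet P

/-- (i) under the parity-separation hypothesis. [cite: BravyiTerhal2009, §2 proof of Prop. 1] -/
theorem mem_of_mem_supportedOn_parityClass' {S : Submodule (ZMod 2) (SympVec n)}
    (hS : S = Submodule.span (ZMod 2) (Set.range g))
    (hsep : ∀ a, ∀ q ∈ sympSupport (g a), ∀ q' ∈ sympSupport (g a), β q % 2 = β q' % 2 → β q = β q')
    (h0 : ∀ j, ∀ Q ∈ sympDual S, Q ∈ supportedOn (slab β j) → Q ∈ S)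
    {p : ℕ} {P : SympVec n} (hPd : P ∈ sympDual S) (hPs : P ∈ supportedOn (parityClass β p)) :
    P ∈ S := by
  rw [eq_sum_proj_slab β hPs]
  refine Submodule.sum_mem _ fun j hj => h0 j _ ?_ (proj_mem_supportedOn _ P)
  have hj' : j % 2 = p := (mem_filter.1 hj).2
  subst hS
  exact proj_slab_mem_sympDual_of_parity β g hsep hPd hPs hj'

/-- (ii) under the parity-separation hypothesis: `S̄⊥ ≤ S̄`. [cite: BravyiTerhal2009, §2 proof of Prop. 1 and of Thm. 1] -/
theorem sympDual_le_of_slabs' {S : Submodule (ZMod 2) (SympVec n)}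
    (hS : S = Submodule.span (ZMod 2) (Set.range g)) (hself : IsSelfOrthogonal S)
    (hsep : ∀ a, ∀ q ∈ sympSupport (g a), ∀ q' ∈ sympSupport (g a), β q % 2 = β q' % 2 → β q = β q')
    (h0 : ∀ j, ∀ Q ∈ sympDual S, Q ∈ supportedOn (slab β j) → Q ∈ S) : sympDual S ≤ S := by
  intro P hP
  have hU : (sympDual S ⊓ supportedOn (parityClass β 1) : Submodule (ZMod 2) (SympVec n)) ≤ S :=
    fun Q hQ => mem_of_mem_supportedOn_parityClass' β g hS hsep h0 hQ.1 hQ.2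
  have hP' : P ∈ S ⊔ (sympDual S ⊓ supportedOn (parityClass β 1)ᶜ) := by
    rw [sup_sympDual_inf_supportedOn_compl_eq hself hU]; exact hP
  obtain ⟨s, hs, q, hq, rfl⟩ := Submodule.mem_sup.1 hP'
  have hqs : q ∈ supportedOn (parityClass β 0) := by rw [← compl_parityClass_one]; exact hq.2
  exact Submodule.add_mem _ hs (mem_of_mem_supportedOn_parityClass' β g hS hsep h0 hq.1 hqs)

end Core

/-! ### Slab partitions of the circle `ℤ/L` -/

section Partition

/-- Boundaries `0 = t 0 < t 1 < ⋯ < t K = L` with all widths in `[u, u + 1]` (`u = r − 1`).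
[cite: BravyiTerhal2009, §2 proof of Prop. 1 («strips of width r and r−1»)] -/
structure SlabBoundaries (L K u : ℕ) (t : ℕ → ℕ) : Prop where
  zero : t 0 = 0
  last : t K = L
  lower : ∀ i, i < K → t i + u ≤ t (i + 1)
  upper : ∀ i, i < K → t (i + 1) ≤ t i + (u + 1)

variable {L K u : ℕ} {t : ℕ → ℕ}

/-- The boundaries increase. [cite: BravyiTerhal2009, §2 proof of Prop. 1] -/
theorem SlabBoundaries.mono (h : SlabBoundaries L K u t) {i j : ℕ} (hij : i ≤ j) (hj : j ≤ K) :
    t i ≤ t j := by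
  induction j, hij using Nat.le_induction with
  | base => exact le_rfl
  | succ j hij ih =>
    exact (ih (by omega)).trans ((Nat.le_add_right _ _).trans (h.lower j (by omega)))

/-! ### The slab index of a column -/

/-- Some boundary lies above every column `c < L`. [cite: BravyiTerhal2009, §2 proof of Prop. 1] -/
theorem SlabBoundaries.exists_lt (h : SlabBoundaries L K u t) (hK : 1 ≤ K) {c : ℕ} (hc : c < L) :
    ∃ i, c < t (i + 1) :=
  ⟨K - 1, by rw [Nat.sub_add_cancel hK, h.last]; exact hc⟩

/-- The slab containing column `c`: the least `i` with `c < t (i+1)` (and `K` for `c ≥ L`).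
[cite: BravyiTerhal2009, §2 proof of Prop. 1 (strips A_j)] -/
def slabOf (h : SlabBoundaries L K u t) (hK : 1 ≤ K) (c : ℕ) : ℕ :=
  if hc : c < L then Nat.find (h.exists_lt hK hc) else K

/-- Column `c` lies below the upper boundary of its slab. [cite: BravyiTerhal2009, §2 proof of Prop. 1] -/
theorem lt_t_slabOf_succ (h : SlabBoundaries L K u t) (hK : 1 ≤ K) {c : ℕ} (hc : c < L) :
    c < t (slabOf h hK c + 1) := by
  rw [slabOf, dif_pos hc]; exact Nat.find_spec (h.exists_lt hK hc)

/-- Boundaries of earlier slabs lie at or below `c`. [cite: BravyiTerhal2009, §2 proof of Prop. 1] -/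
theorem t_succ_le_of_lt_slabOf (h : SlabBoundaries L K u t) (hK : 1 ≤ K) {c : ℕ} (hc : c < L) {i : ℕ}
    (hi : i < slabOf h hK c) : t (i + 1) ≤ c := by
  rw [slabOf, dif_pos hc] at hi
  have := Nat.find_min (h.exists_lt hK hc) hi
  omega

/-- Minimality of the slab index. [cite: BravyiTerhal2009, §2 proof of Prop. 1] -/
theorem slabOf_le_of_lt (h : SlabBoundaries L K u t) (hK : 1 ≤ K) {c : ℕ} (hc : c < L) {i : ℕ}
    (hi : c < t (i + 1)) : slabOf h hK c ≤ i := by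
  rw [slabOf, dif_pos hc]; exact Nat.find_le hi

/-- Slab indices are `< K`. [cite: BravyiTerhal2009, §2 proof of Prop. 1] -/
theorem slabOf_lt (h : SlabBoundaries L K u t) (hK : 1 ≤ K) {c : ℕ} (hc : c < L) : slabOf h hK c < K := by
  have := slabOf_le_of_lt h hK hc (i := K - 1) (by rw [Nat.sub_add_cancel hK, h.last]; exact hc)
  omega

/-- Column `c` lies at or above the lower boundary of its slab. [cite: BravyiTerhal2009, §2 proof of Prop. 1] -/
theorem t_slabOf_le (h : SlabBoundaries L K u t) (hK : 1 ≤ K) {c : ℕ} (hc : c < L) :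
    t (slabOf h hK c) ≤ c := by
  rcases Nat.eq_zero_or_pos (slabOf h hK c) with h0 | hpos
  · rw [h0, h.zero]; exact Nat.zero_le _
  · have := t_succ_le_of_lt_slabOf h hK hc (i := slabOf h hK c - 1) (by omega)
    rwa [Nat.sub_add_cancel hpos] at this

/-- Monotonicity of the slab index. [cite: BravyiTerhal2009, §2 proof of Prop. 1] -/
theorem slabOf_mono (h : SlabBoundaries L K u t) (hK : 1 ≤ K) {c c' : ℕ} (hcc' : c ≤ c') (hc' : c' < L) :
    slabOf h hK c ≤ slabOf h hK c' :=
  slabOf_le_of_lt h hK (by omega) (lt_of_le_of_lt hcc' (lt_t_slabOf_succ h hK hc'))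

/-- (W1) Two columns at distance `≤ u` (no wrap-around) lie in the same or in adjacent slabs.
[cite: BravyiTerhal2009, §2 proof of Prop. 1 («each generator overlaps with at most one even strip»)] -/
theorem slabOf_le_succ (h : SlabBoundaries L K u t) (hK : 1 ≤ K) {c c' : ℕ} (hcc' : c ≤ c')
    (hc'u : c' ≤ c + u) (hc' : c' < L) : slabOf h hK c' ≤ slabOf h hK c + 1 := by
  by_contra hlt
  push Not at hlt
  have hc : c < L := by omega
  have hK' := slabOf_lt h hK hc'
  have h1 : t (slabOf h hK c + 1 + 1) ≤ t (slabOf h hK c') := h.mono (by omega) hK'.le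
  have h2 := t_slabOf_le h hK hc'
  have h3 := h.lower (slabOf h hK c + 1) (by omega)
  have h4 := lt_t_slabOf_succ h hK hc
  omega

/-- (W2) Wrap-around: if `c' + L ≤ c + u` then `c'` lies in the first slab and `c` in the last.
[cite: BravyiTerhal2009, §2 proof of Prop. 1 (periodic boundary conditions)] -/
theorem slabOf_wrap (h : SlabBoundaries L K u t) (hK : 1 ≤ K) {c c' : ℕ} (hc : c < L) (hc' : c' < L)
    (hwrap : c' + L ≤ c + u) : slabOf h hK c' = 0 ∧ slabOf h hK c = K - 1 := by
  constructor
  · have h1 := h.lower 0 (by omega)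
    rw [h.zero] at h1
    have := slabOf_le_of_lt h hK hc' (i := 0) (by omega)
    omega
  · have h1 := h.lower (K - 1) (by omega)
    rw [Nat.sub_add_cancel hK, h.last] at h1
    have h2 := slabOf_lt h hK hc
    by_contra hne
    have h3 : t (slabOf h hK c + 1) ≤ t (K - 1) := h.mono (by omega) (by omega)
    have h4 := lt_t_slabOf_succ h hK hc
    omega

/-- A slab has at most `u + 1` columns. [cite: BravyiTerhal2009, §2 proof of Prop. 1 (strips of width ≤ r)] -/
theorem card_filter_slabOf_le (h : SlabBoundaries L K u t) (hK : 1 ≤ K) (j : ℕ) :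
    #(univ.filter fun c : Fin L => slabOf h hK c = j) ≤ u + 1 := by
  by_cases hj : j < K
  · calc #(univ.filter fun c : Fin L => slabOf h hK c = j)
        ≤ #(Finset.Ico (t j) (t j + (u + 1))) := by
          refine Finset.card_le_card_of_injOn (fun c : Fin L => (c : ℕ)) ?_ ?_
          · intro c hc
            simp only [coe_filter, mem_univ, true_and, Set.mem_setOf_eq] at hc
            have h1 := t_slabOf_le h hK c.isLt
            have h2 := lt_t_slabOf_succ h hK c.isLt
            have h3 := h.upper j hj
            rw [hc] at h1 h2
            simp only [coe_Ico, Set.mem_Ico]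
            omega
          · intro c₁ _ c₂ _ hc
            exact Fin.ext hc
      _ = u + 1 := by simp
  · have : (univ.filter fun c : Fin L => slabOf h hK c = j) = ∅ := by
      refine filter_eq_empty_iff.2 fun c _ hc => hj ?_
      rw [← hc]; exact slabOf_lt h hK c.isLt
    rw [this]; simp

/-! ### Existence of a balanced partition: `L = a·u + b·(u+1)` with `a + b` even, for `L ≥ 2u²` -/

/-- The boundaries of `a` slabs of width `u` followed by slabs of width `u + 1`.
[cite: BravyiTerhal2009, §2 proof of Prop. 1] -/
def slabT (a u i : ℕ) : ℕ := if i ≤ a then i * u else a * u + (i - a) * (u + 1)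

/-- The first `a` slabs have width `u`. [cite: BravyiTerhal2009, §2 proof of Prop. 1] -/
theorem slabT_of_le {a u i : ℕ} (h : i ≤ a) : slabT a u i = i * u := if_pos h

/-- The later slabs have width `u + 1`. [cite: BravyiTerhal2009, §2 proof of Prop. 1] -/
theorem slabT_of_not_le {a u i : ℕ} (h : ¬ i ≤ a) : slabT a u i = a * u + (i - a) * (u + 1) := if_neg h

/-- For `u ≥ 1` and `L ≥ 2u²` the circle of `L` columns splits into an EVEN number `K ≥ 1` of slabs of
widths `u`, `u + 1` («Let `L = a(r−1) + br` for some integers `a, b` such that `a + b` is even»).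
[cite: BravyiTerhal2009, §2 proof of Prop. 1] -/
theorem exists_slabBoundaries {L u : ℕ} (hu : 1 ≤ u) (hL : 2 * u * u ≤ L) :
    ∃ K t, SlabBoundaries L K u t ∧ K % 2 = 0 ∧ 1 ≤ K := by
  obtain ⟨m, s, hs, hLms⟩ : ∃ m s, s < u ∧ L = m * u + s :=
    ⟨L / u, L % u, Nat.mod_lt _ (by omega), by rw [Nat.div_add_mod']⟩
  have hm : 2 * u ≤ m := by
    by_contra hlt
    push Not at hlt
    have : m * u + s < (2 * u - 1) * u + u := by
      have := Nat.mul_le_mul_right u (show m ≤ 2 * u - 1 by omega)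
      omega
    have h2 : (2 * u - 1) * u + u = 2 * u * u := by
      zify [show 1 ≤ 2 * u by omega]; ring
    omega
  -- a slabs of width u, then b slabs of width u + 1
  obtain ⟨a, b, hab, hKeven, hKpos⟩ : ∃ a b : ℕ, a * u + b * (u + 1) = L ∧ (a + b) % 2 = 0 ∧ 1 ≤ a + b := by
    rcases Nat.even_or_odd m with ⟨m', hm'⟩ | ⟨m', hm'⟩
    · refine ⟨m - s, s, ?_, by omega, by omega⟩
      rw [hLms]
      zify [show s ≤ m by omega]
      ring
    · refine ⟨m - s - (u + 1), s + u, ?_, by omega, by omega⟩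
      rw [hLms]
      zify [show s ≤ m by omega, show u + 1 ≤ m - s by omega]
      ring
  have width : ∀ i, slabT a u (i + 1) = slabT a u i + (if i + 1 ≤ a then u else u + 1) := by
    intro i
    by_cases h1 : i + 1 ≤ a
    · rw [slabT_of_le h1, slabT_of_le (by omega : i ≤ a), if_pos h1, add_mul, one_mul]
    · rw [slabT_of_not_le h1, if_neg h1]
      by_cases h2 : i ≤ a
      · rw [slabT_of_le h2, show i = a by omega, show a + 1 - a = 1 by omega, one_mul]
      · rw [slabT_of_not_le h2, show i + 1 - a = (i - a) + 1 by omega, add_mul, one_mul, add_assoc]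
  refine ⟨a + b, slabT a u, ⟨?_, ?_, ?_, ?_⟩, hKeven, hKpos⟩
  · rw [slabT_of_le (Nat.zero_le _), zero_mul]
  · by_cases hb : b = 0
    · subst hb; rw [add_zero, slabT_of_le le_rfl]; simpa using hab
    · rw [slabT_of_not_le (by omega), show a + b - a = b by omega]; exact hab
  · intro i _
    rw [width i]
    split_ifs <;> omega
  · intro i _
    rw [width i]
    split_ifs <;> omega

end Partition

/-! ### Periodic windows -/

section Lattice

variable {D L : ℕ}

/-- A periodic window of length `r`: `(x − c₀) mod L < r` means `x ∈ [c₀, c₀ + r)` or, wrapping around,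
`x + L ∈ [c₀, c₀ + r)`. [cite: BravyiTerhal2009, §2 Def. 1 / §5 (periodic boundary conditions)] -/
theorem periodic_window_cases {x c₀ : Fin L} {r : ℕ} (h : ((x - c₀ : Fin L) : ℕ) < r) :
    ((c₀ : ℕ) ≤ x ∧ (x : ℕ) < c₀ + r) ∨ ((x : ℕ) < c₀ ∧ (x : ℕ) + L < c₀ + r) := by
  have hL : 0 < L := Fin.pos x
  rw [Fin.sub_def] at h
  dsimp only at h
  by_cases hcx : (c₀ : ℕ) ≤ x
  · left
    have key : (L - (c₀ : ℕ) + x) % L = (x : ℕ) - c₀ := by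
      have : L - (c₀ : ℕ) + x = ((x : ℕ) - c₀) + L := by omega
      rw [this, Nat.add_mod_right, Nat.mod_eq_of_lt]
      exact lt_of_le_of_lt (Nat.sub_le _ _) x.isLt
    rw [key] at h
    omega
  · right
    have key : (L - (c₀ : ℕ) + x) % L = L - (c₀ : ℕ) + x := Nat.mod_eq_of_lt (by omega)
    rw [key] at h
    omega

end Lattice

/-! ### Theorem 1, periodic boundary conditions -/

/-- **Bravyi–Terhal 2009, Theorem 1 on the torus, proved** (discharge of
`BravyiTerhal2009_thm1_periodic`): on `(ℤ/L)^D`, `D ≥ 1`, with every generator covered by a hypercube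
with `r^D` vertices modulo `L` (`r ≥ 1`) and `L ≥ 2(r−1)²`, a stabilizer code with `k ≥ 1` has
`d ≤ r · L^{D−1}`. [cite: BravyiTerhal2009, §1.1 Thm. 1 with §2 Prop. 1 (periodic boundary conditions, L ≥ 2(r−1)²)] -/
theorem BravyiTerhal2009_thm1_periodic_holds : BravyiTerhal2009_thm1_periodic := by
  intro D L r n k d e S hD hr hL hloc hcode hk
  obtain ⟨D', rfl⟩ : ∃ D', D = D' + 1 := ⟨D - 1, by omega⟩
  rw [Nat.add_sub_cancel]
  by_contra hlt
  push Not at hlt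
  -- the local generators
  set T : Set (SympVec n) := {v | v ∈ S ∧ IsCubeLocalPeriodic e r v} with hT
  have hS : S = Submodule.span (ZMod 2) (Set.range (Subtype.val : T → SympVec n)) := by
    rw [Subtype.range_coe]
    exact le_antisymm hloc (Submodule.span_le.2 fun v hv => hv.1)
  -- a slab index β on the qubits with: (sep) a generator meets at most one slab of each parity,
  -- (card) every slab has ≤ r L^{D'} qubits
  obtain ⟨β, hsep, hcard⟩ : ∃ β : Fin n → ℕ,
      (∀ a : T, ∀ q ∈ sympSupport (a : SympVec n), ∀ q' ∈ sympSupport (a : SympVec n),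
        β q % 2 = β q' % 2 → β q = β q') ∧
      (∀ j, #(slab β j) ≤ r * L ^ D') := by
    rcases Nat.lt_or_ge r 2 with hr1 | hr2
    · -- r = 1: slabs = single columns; a generator lives in one column
      have hr1' : r = 1 := by omega
      subst hr1'
      refine ⟨fun q => ((e q) 0 : ℕ), ?_, ?_⟩
      · intro a q hq q' hq' _
        dsimp only
        obtain ⟨c, hc⟩ := a.2.2
        have h1 := periodic_window_cases (hc q hq 0)
        have h2 := periodic_window_cases (hc q' hq' 0)
        have := ((e q) 0).isLt
        have := ((e q') 0).isLt
        have := (c 0).isLt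
        omega
      · intro j
        classical
        have hslab : slab (fun q => ((e q) 0 : ℕ)) j =
            (univ.filter fun x : Fin (D' + 1) → Fin L =>
              x 0 ∈ (univ.filter fun t : Fin L => (t : ℕ) = j)).map e.symm.toEmbedding := by
          ext q; simp [slab, Finset.mem_map_equiv]
        rw [hslab, Finset.card_map, card_filter_apply_zero_mem, one_mul]
        refine (Nat.mul_le_mul_right _ ?_).trans (le_of_eq (one_mul _))
        rw [Finset.card_le_one]
        intro a ha b hb
        simp only [mem_filter, mem_univ, true_and] at ha hb
        exact Fin.ext (by omega)
    · -- r ≥ 2: balanced partition of the circle into an even number of slabs of widths r-1, r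
      obtain ⟨K, t, ht, hKeven, hKpos⟩ :=
        exists_slabBoundaries (u := r - 1) (L := L) (by omega)
          (by have : 2 * (r - 1) * (r - 1) = 2 * (r - 1) ^ 2 := by ring
              omega)
      refine ⟨fun q => slabOf ht hKpos ((e q) 0 : ℕ), ?_, ?_⟩
      · intro a q hq q' hq' hpar
        dsimp only at hpar ⊢
        obtain ⟨c, hc⟩ := a.2.2
        have h1 := periodic_window_cases (hc q hq 0)
        have h2 := periodic_window_cases (hc q' hq' 0)
        have hx := ((e q) 0).isLt
        have hx' := ((e q') 0).isLt
        have hc₀L := (c 0).isLt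
        -- abbreviations
        set x : ℕ := ((e q) 0 : ℕ) with hxdef
        set x' : ℕ := ((e q') 0 : ℕ) with hx'def
        set c₀ : ℕ := ((c 0 : Fin L) : ℕ) with hc₀
        have hK2 : 2 ≤ K := by omega
        -- no wrap between x and x' : |x - x'| ≤ r - 1
        have nowrap : ∀ {y y' : ℕ}, y ≤ y' → y' ≤ y + (r - 1) → y' < L →
            slabOf ht hKpos y % 2 = slabOf ht hKpos y' % 2 → slabOf ht hKpos y = slabOf ht hKpos y' := by
          intro y y' hyy' hy'u hy'L hp
          have a1 := slabOf_mono ht hKpos hyy' hy'L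
          have a2 := slabOf_le_succ ht hKpos hyy' hy'u hy'L
          omega
        have wrap : ∀ {y y' : ℕ}, y < L → y' < L → y' + L ≤ y + (r - 1) →
            slabOf ht hKpos y % 2 ≠ slabOf ht hKpos y' % 2 := by
          intro y y' hyL hy'L hw
          obtain ⟨b1, b2⟩ := slabOf_wrap ht hKpos hyL hy'L hw
          rw [b1, b2]
          omega
        rcases h1 with ⟨h1a, h1b⟩ | ⟨h1a, h1b⟩ <;> rcases h2 with ⟨h2a, h2b⟩ | ⟨h2a, h2b⟩
        · rcases le_total x x' with hle | hle
          · exact nowrap hle (by omega) hx' hpar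
          · exact (nowrap hle (by omega) hx hpar.symm).symm
        · exact absurd hpar (wrap hx hx' (by omega))
        · exact absurd hpar.symm (wrap hx' hx (by omega))
        · rcases le_total x x' with hle | hle
          · exact nowrap hle (by omega) hx' hpar
          · exact (nowrap hle (by omega) hx hpar.symm).symm
      · intro j
        classical
        have hslab : slab (fun q => slabOf ht hKpos ((e q) 0 : ℕ)) j =
            (univ.filter fun x : Fin (D' + 1) → Fin L =>
              x 0 ∈ (univ.filter fun c : Fin L => slabOf ht hKpos c = j)).map e.symm.toEmbedding := by
          ext q; simp [slab, Finset.mem_map_equiv]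
        rw [hslab, Finset.card_map, card_filter_apply_zero_mem]
        refine Nat.mul_le_mul_right _ ((card_filter_slabOf_le ht hKpos j).trans (by omega))
  -- no slab supports a non-trivial logical operator
  have h0 : ∀ j, ∀ Q ∈ sympDual S, Q ∈ supportedOn (slab β j) → Q ∈ S := by
    intro j Q hQd hQs
    by_contra hQS
    have h1 := hcode.2.2.1 Q hQd hQS
    have h2 := sympWeight_le_card_of_mem hQs
    have h3 := hcard j
    omega
  have hle := Submodule.finrank_mono (sympDual_le_of_slabs' β _ hS hcode.1 hsep h0)
  rw [hcode.finrank_sympDual] at hle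
  have hdim := hcode.2.1
  omega

end Literature.InformationTheory.QuantumCodes
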